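import Literature.Analysis.FluidPDE.TaoEnstrophyLocalisation
import Literature.Analysis.FluidPDE.VorticityCalculus
import Literature.Analysis.FluidPDE.ClassicalSolutionCalculus
import HarnessLib

/-!
# The curl of the convective term: `curl((u·∇)u) = (u·∇)ω − (ω·∇)u + (div u) ω`

Analysis/FluidPDE support file (serves the §10 enstrophy argument of Tao 2011, Thm. 10.1, whose
vorticity equation (10.18) `∂ₜω + (u·∇)ω = Δω + O(ω∇u) + ∇ × f` is the curl of the momentum
equation, and the tree's named fact `Fluid.IsClassicalNSSolutionOn.isVorticitySolutionOn`
(`Vorticity.lean`, "using `curl ((u·∇)u) = (u·∇)ω − (ω·∇)u` for `div u = 0`")). We **prove** the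
pointwise identity on `ℝ³`

  `curl ((u·∇)u)(x) = (u·∇)ω(x) − (ω·∇)u(x) + (div u(x)) ω(x)`,  `ω = curl u`,

for `u ∈ C²` (`Fluid.curl_convect_self`), and its divergence-free form
(`Fluid.curl_convect_self_of_isDivFree`). Proof: `D((u·∇)u)(x) = Du(x) ∘ Du(x) + D²u(x)(·, u(x))`
(product rule for the evaluation `y ↦ Du(y)(u(y))`); the curl of the second summand is
`(u·∇)ω(x)` by the symmetry of `D²u(x)` and `D(curl u) = curlCLM ∘ D²u`; the curl of the first is
the matrix identity `curl(L ∘ L) = −L(curl L) + (tr L) curl L` for `L : ℝ³ → ℝ³` linear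
(`Fluid.curlCLM_comp_self`, checked in coordinates), and `L(curl L) = (ω·∇)u`, `tr L = div u`
for `L = Du(x)`.

## References

* A. J. Majda, A. L. Bertozzi, *Vorticity and incompressible flow* (CUP 2002), §1.1 (vector
  identities) and eq. (1.33) / Prop. 1.12 (the vorticity equation).
* T. Tao, arXiv:1108.1165 (`Tao2011`), §10, (10.18).
-/

noncomputable section

open InnerProductSpace
open scoped RealInnerProductSpace Laplacian ContDiff

namespace Literature.Analysis.FluidPDE

/-- Local notation for physical space `ℝ³ = EuclideanSpace ℝ (Fin 3)`. -/
local notation "ℝ³" => EuclideanSpace ℝ (Fin 3)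

/-- Local notation for the standard basis vectors. -/
local notation "𝐞" j => EuclideanSpace.single (j : Fin 3) (1 : ℝ)

/-! ## Coordinates -/

/-- Unfolding `curlCLM` (definitional). [folklore] -/
theorem curlCLM_apply (D : ℝ³ →L[ℝ] ℝ³) :
    curlCLM D = WithLp.toLp 2 ![D (𝐞 1) 2 - D (𝐞 2) 1, D (𝐞 2) 0 - D (𝐞 0) 2,
      D (𝐞 0) 1 - D (𝐞 1) 0] := rfl

/-- Expansion of a linear map in the standard coordinates of `ℝ³`:
`(L v)ᵢ = ∑ₘ vₘ (L eₘ)ᵢ`. [folklore] -/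
theorem clm_apply_coord (L : ℝ³ →L[ℝ] ℝ³) (v : ℝ³) (i : Fin 3) :
    L v i = ∑ m, v m * L (𝐞 m) i := by
  have hv : v = ∑ m, v m • (𝐞 m) := by
    simpa using ((EuclideanSpace.basisFun (Fin 3) ℝ).sum_repr v).symm
  conv_lhs => rw [hv]
  simp [map_sum, map_smul, Finset.sum_apply]

/-- The trace of a linear map of `ℝ³` in standard coordinates: `tr L = ∑ₘ (L eₘ)ₘ`. [folklore] -/
theorem trace_eq_sum_coord (L : ℝ³ →L[ℝ] ℝ³) :
    LinearMap.trace ℝ ℝ³ (L : ℝ³ →ₗ[ℝ] ℝ³) = ∑ m, L (𝐞 m) m := by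
  rw [LinearMap.trace_eq_sum_inner _ (EuclideanSpace.basisFun (Fin 3) ℝ)]
  simp [EuclideanSpace.basisFun_apply, EuclideanSpace.inner_single_left]

/-! ## The matrix identity `curl(L ∘ L) = −L(curl L) + (tr L) curl L` -/

/-- For a linear map `L` of `ℝ³` with matrix `Lᵢⱼ = (L eⱼ)ᵢ`:
`curl(L ∘ L) = −L (curl L) + (tr L) · curl L`, where `curl L = curlCLM L = (L₃₂ − L₂₃, …)` is
the axial vector of the antisymmetric part (the algebra behind
`εᵢⱼₖ ∂ⱼuₗ ∂ₗuₖ = −(ω·∇)uᵢ + ωᵢ div u`). [folklore] -/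
theorem curlCLM_comp_self (L : ℝ³ →L[ℝ] ℝ³) :
    curlCLM (L.comp L) = -(L (curlCLM L)) + (LinearMap.trace ℝ ℝ³ (L : ℝ³ →ₗ[ℝ] ℝ³)) • curlCLM L := by
  have hL : L (curlCLM L) = ∑ m, (curlCLM L) m • L (𝐞 m) := by
    conv_lhs => rw [show curlCLM L = ∑ m, (curlCLM L) m • (𝐞 m) from by
      simpa using ((EuclideanSpace.basisFun (Fin 3) ℝ).sum_repr (curlCLM L)).symm]
    simp [map_sum, map_smul]
  have hc : ∀ v : ℝ³, ∀ k : Fin 3, L (L v) k = ∑ m, (L v) m * L (𝐞 m) k := fun v k =>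
    clm_apply_coord L (L v) k
  rw [hL, trace_eq_sum_coord]
  ext i
  fin_cases i <;> simp [curlCLM_apply, Fin.sum_univ_three, hc] <;> ring

/-! ## The curl of the convective term -/

/-- **`curl ((u·∇)u) = (u·∇)ω − (ω·∇)u + (div u) ω`** pointwise, for `u ∈ C²(ℝ³; ℝ³)` and
`ω = curl u` (Majda–Bertozzi, §1.1 vector identities; the form with `div u = 0` is the one
behind the vorticity equation (1.33)). Here `(u·∇)ω = convect u (curl u)`,
`(ω·∇)u = convect (curl u) u`. [cite: MajdaBertozziCUP2002, §1.1 (vector identities)] -/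
theorem curl_convect_self {u : ℝ³ → ℝ³} (hu : ContDiff ℝ 2 u) (x : ℝ³) :
    curl (convect u u) x =
      convect u (curl u) x - convect (curl u) u x + VectorCalculus.divergence u x • curl u x := by
  -- derivative of `y ↦ Du(y) (u y)`
  have hD : HasFDerivAt (fderiv ℝ u) (fderiv ℝ (fderiv ℝ u) x) x :=
    (((hu.fderiv_right (m := 1) (by norm_num)).differentiable one_ne_zero).differentiableAt).hasFDerivAt
  have hux : HasFDerivAt u (fderiv ℝ u x) x :=
    ((hu.differentiable (by norm_num)) x).hasFDerivAt
  have hconv : HasFDerivAt (convect u u)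
      ((fderiv ℝ u x).comp (fderiv ℝ u x) + (fderiv ℝ (fderiv ℝ u) x).flip (u x)) x := by
    have h := hD.clm_apply hux
    exact h
  -- symmetry of `D²u(x)`: the flipped second derivative at `u x` is `D²u(x)(u x)`
  have hsymm : (fderiv ℝ (fderiv ℝ u) x).flip (u x) = fderiv ℝ (fderiv ℝ u) x (u x) := by
    ext k i
    rw [ContinuousLinearMap.flip_apply]
    exact congrFun (congrArg _ ((hu.contDiffAt.isSymmSndFDerivAt (by simp)) k (u x))) i
  -- assemble
  rw [curl_eq_curlCLM, hconv.fderiv, map_add, curlCLM_comp_self, hsymm]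
  have h1 : curlCLM (fderiv ℝ (fderiv ℝ u) x (u x)) = convect u (curl u) x := by
    rw [convect, fderiv_curl hu x, ContinuousLinearMap.comp_apply]
  have h2 : (fderiv ℝ u x) (curlCLM (fderiv ℝ u x)) = convect (curl u) u x := by
    rw [convect, curl_eq_curlCLM]
  have h3 : LinearMap.trace ℝ ℝ³ (fderiv ℝ u x : ℝ³ →ₗ[ℝ] ℝ³) = VectorCalculus.divergence u x := rfl
  rw [h1, h2, h3, ← curl_eq_curlCLM]
  abel

/-- **`curl ((u·∇)u) = (u·∇)ω − (ω·∇)u` for divergence-free `u ∈ C²`** — the identity that turns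
the curl of the Navier–Stokes momentum equation into the vorticity equation
`∂ₜω + (u·∇)ω = (ω·∇)u + νΔω + curl f` (Majda–Bertozzi (1.33); Tao 2011 (10.18),
"`∂ₜω + (u·∇)ω = Δω + O(ω∇u) + ∇ × f`"). [cite: MajdaBertozziCUP2002, §1.1 (vector identities)] -/
theorem curl_convect_self_of_isDivFree {u : ℝ³ → ℝ³} (hu : ContDiff ℝ 2 u) (hdiv : VectorCalculus.IsDivFree u)
    (x : ℝ³) :
    curl (convect u u) x = convect u (curl u) x - convect (curl u) u x := by
  rw [curl_convect_self hu x, hdiv x, zero_smul, add_zero]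

/-! ## The vorticity equation of a classical solution, stretching form -/

open Set in
/-- **The vorticity equation in stretching form (Tao 2011, (10.18); Majda–Bertozzi (1.33)).**
For a classical Navier–Stokes solution on a time set `S` of unique differentiability,
`curl (∂ₜu)(t, x) = νΔω − (u·∇)ω + (ω·∇)u + curl f` pointwise on `S × ℝ³` (`ω = curl u(t)`):
the curl of the momentum equation, with `curl ∇p = 0` (`curl_gradient_eq_zero_holds`),
`curl Δ = Δ curl` (`curl_laplacian`) and `curl ((u·∇)u) = (u·∇)ω − (ω·∇)u`
(`curl_convect_self_of_isDivFree`). (Combined with `∂ₜ curl = curl ∂ₜ` at interior times this is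
the pointwise vorticity equation (10.18).) [cite: Tao2011, §10, proof of Thm. 10.1 ((10.18))] -/
theorem IsClassicalNSSolutionOn.curl_timeDerivWithin_eq {S : Set ℝ} {ν : ℝ} {f u : ℝ → ℝ³ → ℝ³}
    {p : ℝ → ℝ³ → ℝ} (h : IsClassicalNSSolutionOn S ν f u p) (hS : UniqueDiffOn ℝ S) {t : ℝ}
    (ht : t ∈ S) (x : ℝ³) :
    curl (timeDerivWithin S u t) x =
      ν • (Δ (curl (u t))) x - convect (u t) (curl (u t)) x + convect (curl (u t)) (u t) x
        + curl (f t) x := by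
  have hu3 : ContDiff ℝ 3 (u t) := (h.contDiff_velocity ht).of_le (by norm_cast)
  have hu2 : ContDiff ℝ 2 (u t) := hu3.of_le (by norm_cast)
  have hp2 : ContDiff ℝ 2 (p t) := (h.contDiff_pressure ht).of_le (by norm_cast)
  have hΔ : ContDiff ℝ ∞ fun y => (Δ (u t)) y := (h.smooth_velocity.laplacian hS).contDiff_slice ht
  have hG : ContDiff ℝ ∞ fun y => convect (u t) (u t) y :=
    (h.smooth_velocity.convect h.smooth_velocity hS).contDiff_slice ht
  have hgrad : ContDiff ℝ ∞ fun y => gradient (p t) y := (h.smooth_pressure.gradient hS).contDiff_slice ht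
  have hf : ContDiff ℝ ∞ (f t) := (h.isSmoothSpaceTimeOn_force hS).contDiff_slice ht
  have dΔ : DifferentiableAt ℝ (fun y => ν • (Δ (u t)) y) x :=
    ((hΔ.differentiable (by simp)) x).const_smul ν
  have dG : DifferentiableAt ℝ (fun y => convect (u t) (u t) y) x := (hG.differentiable (by simp)) x
  have dgrad : DifferentiableAt ℝ (fun y => gradient (p t) y) x := (hgrad.differentiable (by simp)) x
  have df : DifferentiableAt ℝ (f t) x := (hf.differentiable (by simp)) x
  -- the momentum equation as an identity of slice functions
  have hEq : timeDerivWithin S u t = fun y =>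
      ((ν • (Δ (u t)) y - convect (u t) (u t) y) - gradient (p t) y) + f t y := by
    funext y
    have e := h.momentum t ht y
    have e' : timeDerivWithin S u t y =
        ν • (Δ (u t)) y - gradient (p t) y + f t y - convect (u t) (u t) y := by
      rw [← e]; abel
    rw [e']; abel
  have h1 : curl (timeDerivWithin S u t) x =
      curl (fun y => (ν • (Δ (u t)) y - convect (u t) (u t) y) - gradient (p t) y) x
        + curl (f t) x := by
    rw [hEq]; exact curl_add ((dΔ.sub dG).sub dgrad) df
  have h2 : curl (fun y => (ν • (Δ (u t)) y - convect (u t) (u t) y) - gradient (p t) y) x =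
      curl (fun y => ν • (Δ (u t)) y - convect (u t) (u t) y) x
        - curl (fun y => gradient (p t) y) x :=
    curl_sub (dΔ.sub dG) dgrad
  have h3 : curl (fun y => gradient (p t) y) x = 0 := curl_gradient_eq_zero_holds _ hp2 x
  have h4 : curl (fun y => ν • (Δ (u t)) y - convect (u t) (u t) y) x =
      ν • curl (Δ (u t)) x - curl (convect (u t) (u t)) x := by
    rw [curl_sub dΔ dG, curl_const_smul ((hΔ.differentiable (by simp)) x) ν]
  rw [h1, h2, h3, sub_zero, h4, curl_laplacian hu3 x,
    curl_convect_self_of_isDivFree hu2 (h.divFree t ht) x]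
  abel

end Literature.Analysis.FluidPDE

end
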